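import Literature.AlgebraicGeometry.HodgeTheory.GlobalInvariantCycles
import Literature.AlgebraicGeometry.Morphisms.AffineSpaceCompactification
import Literature.AlgebraicGeometry.Motives.ProjBaseChangeAny
import HarnessLib

/-!
# Affine `ℂ`-schemes of finite type are quasi-projective over `ℂ`

Family `hodge`, layer `Literature/AlgebraicGeometry/HodgeTheory` (where the predicate
`IsQuasiProjectiveOver` — an open `ℂ`-immersion into a projective `ℂ`-scheme, `Motives.IsProjectiveOver`
= closed `ℂ`-immersion into `ℙᴺ_ℂ = Motives.projectiveSpace N ℂ` — lives, `GlobalInvariantCycles.lean`).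

**An affine scheme of finite type over `ℂ` is quasi-projective over `ℂ`** (Hartshorne II §4,
definition of quasi-projective morphisms with Example 4.8.1 / I Prop. 4.?: an affine variety is
isomorphic to a closed subset of `𝐀ⁿ ⊆ 𝐏ⁿ`, hence quasi-projective; Stacks 0F41 proof, first step).
Proof on the tree's carriers: by Stacks 04II (`Morphisms.exists_isImmersion_comp_eq_of_isAffine`) an
affine `X → Spec ℂ` of finite type admits an immersion `i : X ↪ 𝐀(ι; Spec ℂ)` over `ℂ`; compose with
the open immersion `𝐀(ι; Spec ℂ) ↪ 𝐏(ι; Spec ℂ) = Spec ℂ ×_ℤ 𝐏^{#ι}_ℤ`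
(`Morphisms.affineSpaceToProjectiveSpace`); the quasi-compact immersion `k : X ↪ 𝐏(ι; Spec ℂ)` is an
open immersion onto its scheme-theoretic image `Xc` (Mathlib `Scheme.Hom.toImage`), a closed subscheme
of `𝐏(ι; Spec ℂ)` (`Scheme.Hom.imageι`); and `𝐏(ι; Spec ℂ) ≅ Proj ℂ[x₀, …, x_{#ι}] = ℙ^{#ι}_ℂ` over
`ℂ` because both are the base change of `𝐏^{#ι}_ℤ` to `ℂ` (`Motives.ProjBaseChangeRing.isPullback_projMap'`,
Liu Ex. 3.1.10, and `Spec ℤ` terminal), so `Xc` is projective over `ℂ`.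

* `isPullback_projToSpec_terminal` — `Proj ℂ[x₀,…,xₙ]` with its structure morphism and the
  comparison `Proj ℂ[x] → Proj ℤ[x]` is the fibre product `Spec ℂ ×_{Spec ℤ} Proj ℤ[x]` (over the
  terminal scheme);
* `isoPullback_projToSpec_terminal_inv_projToSpec` — the resulting isomorphism
  `ℙ^{#ι}_ℂ ≅ 𝐏(ι; Spec ℂ)` (`IsPullback.isoPullback`) is over `Spec ℂ`;
* `IsQuasiProjectiveOver.of_isAffine` — the theorem; `IsQuasiProjectiveOver.specOver` — `Spec ℂ`
  itself.

Consumers: the algebraicity-locus fact `charlesSchnell_algebraicityLocus_iUnion_closed` and André's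
deformation theorem ask for quasi-projective bases, while the reductions of Grothendieck's
variational Hodge conjecture (`Summits/HodgeConjecture/…/AnchorTransportVariationalHodgeReductions`,
`…CurveBase`) deliver smooth irreducible AFFINE (curve) bases; this file closes that gap.

## References

* [Hartshorne1977] R. Hartshorne, Algebraic Geometry (1977), II §4 (quasi-projective morphisms,
  p. 103) and II Prop. 2.6 / Ex. 2.14.
* [StacksProject] The Stacks Project, Tag 0F41 (proof, first step), Tag 04II, Tag 01WC.
* [Liu2002] Q. Liu, Algebraic Geometry and Arithmetic Curves (2002), Def. 3.3.35, Ex. 3.1.10.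
-/

noncomputable section

-- Mathlib's pull-back API is stated through `abbrev`s over `limit`; as in Mathlib's own
-- algebraic-geometry files we let `simp`/unification see through them.
set_option backward.isDefEq.respectTransparency false

open CategoryTheory CategoryTheory.Limits AlgebraicGeometry MvPolynomial
open Literature.AlgebraicGeometry.Morphisms Literature.AlgebraicGeometry.Motives

namespace Literature.AlgebraicGeometry.HodgeTheory

section Compare

attribute [local instance] MvPolynomial.gradedAlgebra

variable (ι : Type)

/-- **`ℙⁿ_ℂ = Spec ℂ ×_{Spec ℤ} ℙⁿ_ℤ` over the terminal scheme**: the square with vertex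
`Proj ℂ[x₀,…,xₙ]` (`n = #ι`), legs its structure morphism to `Spec ℂ` and the comparison
`Proj ℂ[x] → Proj ℤ[x]`, over the unique morphisms to the terminal scheme, is cartesian
(`ProjBaseChangeRing.isPullback_projMap'` for `ℤ → ℂ`, Liu Ex. 3.1.10, transported along
`Spec ℤ ≅ ⊤`); for ANY `ℤ`-algebra structure on `ℂ` through `ULift ℤ`, the base ring of the tree's
integral projective space `Morphisms.projectiveSpaceInt` (there is exactly one).
[cite: Liu2002, Prop. 3.1.9 and Ex. 3.1.10] -/
theorem isPullback_projToSpec_terminal [Algebra intU.{0} ℂ] :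
    IsPullback (ProjBaseChangeRing.projToSpec (Fin (Nat.card ι + 1)) ℂ)
      (Proj.map (ProjBaseChangeRing.mapGraded intU.{0} ℂ (Fin (Nat.card ι + 1)))
        (ProjBaseChangeRing.irrelevant_le_map intU.{0} ℂ (Fin (Nat.card ι + 1))))
      (terminal.from (Spec (.of ℂ))) (terminal.from (projectiveSpaceInt ι)) := by
  have hP := (ProjBaseChangeRing.isPullback_projMap' (k := intU.{0}) (L := ℂ)
    (n := Nat.card ι)).flip
  have hiso := isIso_of_isTerminal specULiftZIsTerminal.{0} terminalIsTerminal
    (terminal.from (Spec (.of intU.{0})))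
  refine hP.of_iso (Iso.refl _) (Iso.refl _) (Iso.refl _) (asIso (terminal.from (Spec (.of intU.{0}))))
    (by simp) (by simp) (terminal.hom_ext _ _) (terminal.hom_ext _ _)

/-- The comparison isomorphism `ℙ^{#ι}_ℂ = Proj ℂ[x₀,…,x_{#ι}] ≅ 𝐏(ι; Spec ℂ)`
(`(isPullback_projToSpec_terminal ι).isoPullback`) is over `Spec ℂ`: its inverse followed by the
structure morphism of `Proj ℂ[x]` is the projection `𝐏(ι; Spec ℂ) → Spec ℂ`. [folklore] -/
theorem isoPullback_projToSpec_terminal_inv_projToSpec [Algebra intU.{0} ℂ] :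
    (isPullback_projToSpec_terminal ι).isoPullback.inv ≫
        ProjBaseChangeRing.projToSpec (Fin (Nat.card ι + 1)) ℂ =
      projectiveSpaceFst ι (Spec (.of ℂ)) :=
  (isPullback_projToSpec_terminal ι).isoPullback_inv_fst

end Compare

/-- **An affine `ℂ`-scheme of finite type is quasi-projective over `ℂ`**: it is an open subscheme
(Mathlib `Scheme.Hom.toImage` of the quasi-compact immersion
`X ↪ 𝐀(ι; Spec ℂ) ↪ 𝐏(ι; Spec ℂ) ≅ ℙ^{#ι}_ℂ`, Stacks 04II + 0F41) of a closed subscheme of `ℙ^{#ι}_ℂ`.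
[cite: Hartshorne1977, II §4 Definition (quasi-projective morphism), p. 103]
[cite: StacksProject, Tag 0F41 (proof, first step) and Tag 04II] -/
theorem IsQuasiProjectiveOver.of_isAffine (X : SchemeOver ℂ) [IsAffine X.left]
    [LocallyOfFiniteType X.hom] : IsQuasiProjectiveOver X := by
  obtain ⟨ι, _, i, hi, hfac⟩ := exists_isImmersion_comp_eq_of_isAffine X.hom
  haveI := hi
  letI : Algebra intU.{0} ℂ := ((Int.castRingHom ℂ).comp ULift.ringEquiv.toRingHom).toAlgebra
  -- the immersion into `𝐏(ι; Spec ℂ)` is quasi-compact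
  set k := i ≫ affineSpaceToProjectiveSpace ι (Spec (.of ℂ)) with hk
  haveI : IsImmersion k := inferInstance
  haveI : CompactSpace X.left := isCompact_univ_iff.mp (isAffineOpen_top X.left).isCompact
  haveI : QuasiCompact X.hom := (HasAffineProperty.iff_of_isAffine (P := @QuasiCompact)).mpr ‹_›
  haveI : QuasiCompact (k ≫ projectiveSpaceFst ι (Spec (.of ℂ))) := by
    rw [hk, Category.assoc, affineSpaceToProjectiveSpace_fst, hfac]
    infer_instance
  haveI : QuasiCompact k := .of_comp k (projectiveSpaceFst ι (Spec (.of ℂ)))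
  -- the scheme-theoretic image, a closed subscheme of `𝐏(ι; Spec ℂ) ≅ ℙ^{#ι}_ℂ`, as a `ℂ`-scheme
  have hkfac : k.toImage ≫ (k.imageι ≫ projectiveSpaceFst ι (Spec (.of ℂ))) = X.hom := by
    rw [k.toImage_imageι_assoc, hk, Category.assoc, affineSpaceToProjectiveSpace_fst, hfac]
  refine ⟨Over.mk (k.imageι ≫ projectiveSpaceFst ι (Spec (.of ℂ))), Over.homMk k.toImage hkfac,
    ⟨Nat.card ι, Over.homMk (k.imageι ≫ (isPullback_projToSpec_terminal ι).isoPullback.inv) ?_, ?_⟩, ?_⟩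
  · change (k.imageι ≫ (isPullback_projToSpec_terminal ι).isoPullback.inv) ≫ (Motives.projectiveSpace (Nat.card ι) ℂ).hom =
      k.imageι ≫ projectiveSpaceFst ι (Spec (.of ℂ))
    rw [projectiveSpace_hom_eq_projToSpec, Category.assoc, isoPullback_projToSpec_terminal_inv_projToSpec]
  · change IsClosedImmersion (k.imageι ≫ (isPullback_projToSpec_terminal ι).isoPullback.inv)
    infer_instance
  · change IsOpenImmersion k.toImage
    infer_instance

/-- `Spec ℂ` is quasi-projective over `ℂ` (affine of finite type). [folklore] -/
theorem IsQuasiProjectiveOver.specOver : IsQuasiProjectiveOver (Motives.specOver ℂ ℂ) := by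
  haveI : IsAffine (Motives.specOver ℂ ℂ).left := inferInstanceAs (IsAffine (Spec _))
  haveI : LocallyOfFiniteType (Motives.specOver ℂ ℂ).hom := by
    change LocallyOfFiniteType (Spec.map _)
    rw [show CommRingCat.ofHom (algebraMap ℂ ℂ) = 𝟙 _ from rfl, Spec.map_id]
    infer_instance
  exact IsQuasiProjectiveOver.of_isAffine _

end Literature.AlgebraicGeometry.HodgeTheory

end
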